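import Literature.Analysis.Fourier.FractalUncertaintyAdaptedWeight
import Literature.Analysis.Fourier.QuantitativeBeurlingMalliavin
import HarnessLib

/-!
# BD18 Lemma 3.1 (the adapted multiplier) from the Beurling–Malliavin theorem

Topic `Literature/Analysis/Fourier`. J. Bourgain, S. Dyatlov, *Spectral gaps without the pressure
condition*, Ann. of Math. 187 (2018). Glue between two proved reductions in the tree:

* `adapted_multiplier_of_quantitativeBM` (`FractalUncertaintyAdaptedWeight.lean`): Lemma 3.1
  from Lemma 2.11 (the quantitative multiplier lemma, taken as a hypothesis on weights
  `ω = e^{-Ω}`);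
* `bd18_lemma_2_11_of_multiplierTheorem` (`QuantitativeBeurlingMalliavin.lean`): Lemma 2.11 from
  Theorem 5 (the Beurling–Malliavin multiplier theorem, taken as the hypothesis `hBM`).

Result: `bd18_lemma_3_1_of_multiplierTheorem` — **Lemma 3.1 from Theorem 5** (sorry-free; the
only remaining input is the Beurling–Malliavin theorem itself, which Mathlib cannot yet prove).
The adapter passes from `Ω ≥ 0` with `|Ω'| ≤ C₀`, `∫ Ω/(1+ξ²) ≤ C₀` to `ω = exp(-Ω) ∈ C¹(ℝ;(0,1])`
with `|∂ log ω| ≤ C₀`, `∫ |log ω|/(1+ξ²) ≤ C₀`, and back (`ω^c = exp(-cΩ)`).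
-/

namespace Literature.Analysis.Fourier

open _root_.MeasureTheory Set
open scoped FourierTransform

/-- **BD18 Lemma 2.11 in exponent form**, from Theorem 5: for all `C₀, c₀ > 0` there is `c > 0`
such that every `C¹` exponent `Ω ≥ 0` with `|Ω'| ≤ C₀` and `∫ Ω/(1+ξ²) ≤ C₀` admits
`ψ ∈ L¹ ∩ L²`, `supp ψ ⊂ [-c₀, c₀]`, `|ψ̂| ≤ e^{-cΩ}`, `‖ψ̂‖²_{L²([-1,1])} ≥ c²`.
[cite: BourgainDyatlov2018, Lemma 2.11] -/
theorem bd18_lemma_2_11_exponent_of_multiplierTheorem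
    (hBM : ∀ ω : ℝ → ℝ, ContDiff ℝ 1 ω → (∀ ξ, 0 < ω ξ) → (∀ ξ, ω ξ ≤ 1) →
      Integrable (fun ξ => |Real.log (ω ξ)| / (1 + ξ ^ 2)) →
      (∃ C : ℝ, ∀ ξ, |deriv (fun η => Real.log (ω η)) ξ| ≤ C) →
      ∀ c₀ : ℝ, 0 < c₀ → ∃ ψ : ℝ → ℂ, MemLp ψ 2 volume ∧ (∀ x, x ∉ Icc (-c₀) c₀ → ψ x = 0) ∧
        (∀ ξ, ‖𝓕 ψ ξ‖ ≤ ω ξ) ∧ ¬ (ψ =ᵐ[volume] 0))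
    (C₀ c₀ : ℝ) (_hC₀ : 0 < C₀) (hc₀ : 0 < c₀) :
    ∃ c : ℝ, 0 < c ∧ ∀ Ω : ℝ → ℝ,
      ContDiff ℝ 1 Ω → (∀ ξ, 0 ≤ Ω ξ) → (∀ ξ, |deriv Ω ξ| ≤ C₀) →
      Integrable (fun ξ => Ω ξ / (1 + ξ ^ 2)) → ∫ ξ, Ω ξ / (1 + ξ ^ 2) ≤ C₀ →
      ∃ ψ : ℝ → ℂ, Integrable ψ ∧ MemLp ψ 2 volume ∧ (∀ x, c₀ < |x| → ψ x = 0) ∧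
        (∀ ξ, ‖(𝓕 ψ : ℝ → ℂ) ξ‖ ≤ Real.exp (-(c * Ω ξ))) ∧
        c ^ 2 ≤ ∫ ξ in Icc (-1 : ℝ) 1, ‖(𝓕 ψ : ℝ → ℂ) ξ‖ ^ 2 := by
  obtain ⟨c, hc, hmain⟩ := bd18_lemma_2_11_of_multiplierTheorem hBM C₀ c₀ hc₀
  set c' : ℝ := min c 1 with hc'
  have hc'pos : 0 < c' := lt_min hc one_pos
  have hc'le : c' ≤ c := min_le_left _ _
  have hc'1 : c' ≤ 1 := min_le_right _ _
  refine ⟨c', hc'pos, fun Ω hΩcd hΩnn hΩderiv hΩint hΩle => ?_⟩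
  -- the weight `ω = exp(-Ω)`
  set ω : ℝ → ℝ := fun ξ => Real.exp (-Ω ξ) with hωdef
  have hωcd : ContDiff ℝ 1 ω := Real.contDiff_exp.comp hΩcd.neg
  have hωpos : ∀ ξ, 0 < ω ξ := fun ξ => Real.exp_pos _
  have hωle : ∀ ξ, ω ξ ≤ 1 := fun ξ => Real.exp_le_one_iff.2 (by linarith [hΩnn ξ])
  have hlog : (fun η => Real.log (ω η)) = fun η => -Ω η := funext fun η => Real.log_exp _
  have habs : ∀ ξ, |Real.log (ω ξ)| = Ω ξ := fun ξ => by
    rw [Real.log_exp, abs_neg, abs_of_nonneg (hΩnn ξ)]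
  have hωint : Integrable (fun ξ => |Real.log (ω ξ)| / (1 + ξ ^ 2)) := by
    simp_rw [habs]; exact hΩint
  have hωI : ∫ ξ, |Real.log (ω ξ)| / (1 + ξ ^ 2) ≤ C₀ := by
    simp_rw [habs]; exact hΩle
  have hωderiv : ∀ ξ, |deriv (fun η => Real.log (ω η)) ξ| ≤ C₀ := by
    intro ξ
    rw [hlog, show (fun η => -Ω η) = -Ω from rfl, deriv.neg, abs_neg]
    exact hΩderiv ξ
  obtain ⟨ψ, hψ2, hψsupp, hψle, hψL2⟩ := hmain ω hωcd hωpos hωle hωint hωI hωderiv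
  -- `ψ ∈ L¹`
  have hψ1 : Integrable ψ := by
    have hb : volume (Icc (-c₀) c₀) < ⊤ := measure_Icc_lt_top
    exact memLp_one_iff_integrable.1
      (hψ2.mono_exponent_of_measure_support_ne_top hψsupp hb.ne (by norm_num))
  refine ⟨ψ, hψ1, hψ2, fun x hx => hψsupp x ?_, fun ξ => (hψle ξ).trans ?_, ?_⟩
  · intro hmem
    rw [mem_Icc, ← abs_le] at hmem
    linarith
  · -- `ω^c ≤ exp(-c' Ω)`
    rw [hωdef]
    simp only
    rw [← Real.exp_mul, Real.exp_le_exp]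
    nlinarith [hΩnn ξ]
  · -- `c'² ≤ c ≤ ∫_{(-1,1)} ≤ ∫_{[-1,1]}`
    have h1 : c' ^ 2 ≤ c := by nlinarith
    have hcont : Continuous (𝓕 ψ) :=
      Literature.Analysis.FunctionSpaces.continuous_fourierIntegral hψ1
    have h2 : ∫ ξ in Ioo (-1 : ℝ) 1, ‖𝓕 ψ ξ‖ ^ 2 ≤ ∫ ξ in Icc (-1 : ℝ) 1, ‖𝓕 ψ ξ‖ ^ 2 :=
      setIntegral_mono_set ((hcont.norm.pow 2).integrableOn_Icc)
        (Filter.Eventually.of_forall fun ξ => by positivity)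
        (Filter.Eventually.of_forall Ioo_subset_Icc_self)
    linarith

/-- **BD18 Lemma 3.1 from BD18 Theorem 5 (Beurling–Malliavin).** For `0 < δ < 1`, `C_R ≥ 1`,
`c₁ > 0` there is `c₂ = c₂(δ, C_R, c₁) > 0` such that every `Y ⊂ [-α₁, α₁]`, `δ`-regular with
constant `C_R` on scales `2` to `α₁`, admits `ψ ∈ L¹ ∩ L²` with `supp ψ ⊂ [-c₁/10, c₁/10]`,
`‖ψ̂‖²_{L²([-1,1])} ≥ c₂²`, `|ψ̂(ξ)| ≤ exp(-c₂⟨ξ⟩^{1/2})` and `|ψ̂(ξ)| ≤ exp(-c₂ θ(ξ)|ξ|)` on `Y`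
(`θ(ξ) = log(10+|ξ|)^{-(1+δ)/2}`), GIVEN the Beurling–Malliavin multiplier theorem `hBM`
(BD18 Theorem 5, verbatim). [cite: BourgainDyatlov2018, Lemma 3.1] -/
theorem bd18_lemma_3_1_of_multiplierTheorem
    (hBM : ∀ ω : ℝ → ℝ, ContDiff ℝ 1 ω → (∀ ξ, 0 < ω ξ) → (∀ ξ, ω ξ ≤ 1) →
      Integrable (fun ξ => |Real.log (ω ξ)| / (1 + ξ ^ 2)) →
      (∃ C : ℝ, ∀ ξ, |deriv (fun η => Real.log (ω η)) ξ| ≤ C) →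
      ∀ c₀ : ℝ, 0 < c₀ → ∃ ψ : ℝ → ℂ, MemLp ψ 2 volume ∧ (∀ x, x ∉ Icc (-c₀) c₀ → ψ x = 0) ∧
        (∀ ξ, ‖𝓕 ψ ξ‖ ≤ ω ξ) ∧ ¬ (ψ =ᵐ[volume] 0))
    {δ C_R c₁ : ℝ} (hδ0 : 0 < δ) (hδ1 : δ < 1) (hC : 1 ≤ C_R) (hc₁ : 0 < c₁) :
    ∃ c₂ : ℝ, 0 < c₂ ∧ ∀ (α₁ : ℝ) (Y : Set ℝ), Y ⊆ Icc (-α₁) α₁ → IsRegularSet Y δ C_R 2 α₁ →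
      ∃ ψ : ℝ → ℂ, Integrable ψ ∧ MemLp ψ 2 volume ∧ (∀ x, c₁ / 10 < |x| → ψ x = 0) ∧
        c₂ ^ 2 ≤ ∫ ξ in Icc (-1 : ℝ) 1, ‖(𝓕 ψ : ℝ → ℂ) ξ‖ ^ 2 ∧
        (∀ ξ, ‖(𝓕 ψ : ℝ → ℂ) ξ‖ ≤ Real.exp (-(c₂ * (1 + ξ ^ 2) ^ (1 / 4 : ℝ)))) ∧
        ∀ ξ ∈ Y, ‖(𝓕 ψ : ℝ → ℂ) ξ‖ ≤
          Real.exp (-(c₂ * (Real.log (10 + |ξ|) ^ (-(1 + δ) / 2) * |ξ|))) :=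
  adapted_multiplier_of_quantitativeBM hδ0 hδ1 hC hc₁
    (fun C₀ c₀ hC₀ hc₀ => bd18_lemma_2_11_exponent_of_multiplierTheorem hBM C₀ c₀ hC₀ hc₀)

end Literature.Analysis.Fourier
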